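import Mathlib.Algebra.Order.BigOperators.Ring.Finset
import Literature.Computability.Complexity.PrivateCoinGamesTools
import HarnessLib

/-!
# Private-coin games: revealing part of the coins, and families of games in parallel

Trunk T-CPLX-CORE, continuation of `PrivateCoinGames.lean` (`PCGame`, `opt`, `prod`,
`opt_prod_le`) and `PrivateCoinGamesTools.lean` (`opt_zero`/`opt_succ_of_even`/`…not_even`,
`opt_mono`, `opt_union_le`, `opt_indep_le`). Two more structural bounds on the backward-induction
value `opt`, both used to analyse constant-round protocols whose later moves are FRESH-COIN
sub-tests of claims the prover committed to earlier (Goldwasser–Sipser lower bounds, Aiello–Håstad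
upper bounds, run after the prover's size claims, as in the App. D protocol of
Akavia–Goldreich–Goldwasser–Moshkovitz behind `Literature.Barriers.PneNP.AkaviaEtAl2006_complMemIPk`):

* `PCGame.fibre G π s` — the game `G` with its coins restricted to the fibre `π⁻¹(s)` of a map
  `π : R → S` ("the prover is told `π r`"), and **`opt_le_sum_opt_fibre`**:
  `opt_G n h ≤ Σ_s opt_{G|π⁻¹(s)} n h` — telling the prover more can only help it (at the
  verifier's turn the sum over messages commutes with the sum over fibres; at the prover's turn a
  best reply for the whole is no better than best replies fibre by fibre). With `π = (r ↦ r₁)` on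
  `R = R₁ × R₂` this reduces the analysis of a test run with the fresh coins `r₂` after a
  commitment to the per-`r₁` test, in which the committed claim and its truth are constants.
* `PCGame.piGame G` for a family `G : Fin d → PCGame R M` — the `d` games in parallel with
  independent coins `Fin d → R`, messages `Fin d → M`, accept iff all accept;
  `consistent_piGame_iff`, and **`opt_piGame_le`**: `opt_{Π G} n h ≤ Π_j opt_{G j} n (h.map (· j))`
  against joint provers correlating their replies arbitrarily (the finite-family form of
  `opt_prod_le`; the leaf is in fact an equality).

Mathlib + the two game files only, all proved; [folklore] (backward induction on game trees).

## References

* [AroraBarakCC2009] S. Arora, B. Barak, *Computational Complexity: A Modern Approach*, CUP 2009,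
  §8.1 (Def. 8.6, Lemma 8.7 and remarks: deterministic provers, parallel repetition).
* O. Goldreich, *Modern Cryptography, Probabilistic Proofs and Pseudorandomness*, Springer 1999,
  App. C.1 (parallel repetition of interactive proofs).
-/

namespace Literature.Computability.Complexity

open Finset

namespace PCGame

variable {R M : Type*}

/-! ### Restricting the coins to a fibre ("the prover is told `π r`") -/

section Fibre

variable (G : PCGame R M) {S : Type*} (π : R → S)

/-- **The game on the fibre `π⁻¹(s)`**: same messages and verdicts, coins restricted to
`{r | π r = s}`. [folklore] -/
def fibre (s : S) : PCGame {r : R // π r = s} M where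
  next r h := G.next r.1 h
  accept r h := G.accept r.1 h

/-- Consistency in the fibre game is consistency in `G`. [folklore] -/
theorem consistent_fibre_iff (s : S) (r : {r : R // π r = s}) (h : List M) :
    (G.fibre π s).Consistent r h ↔ G.Consistent r.1 h :=
  Iff.rfl

variable [Fintype R] [Fintype M] [Fintype S] [DecidableEq S]

open scoped Classical in
/-- The leaf count splits over the fibres (an equality). [folklore] -/
theorem opt_zero_eq_sum_fibre (h : List M) :
    G.opt 0 h = ∑ s, (G.fibre π s).opt 0 h := by
  rw [opt_zero, card_eq_sum_card_fiberwise (f := π) (t := univ) fun _ _ => mem_univ _]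
  refine sum_congr rfl fun s _ => ?_
  rw [opt_zero]
  refine card_bij' (fun r hr => ⟨r, (mem_filter.1 hr).2⟩) (fun r _ => r.1) ?_ ?_ ?_ ?_
  · intro r hr
    simp only [mem_filter, mem_univ, true_and] at hr ⊢
    exact hr.1
  · intro r hr
    simp only [mem_filter, mem_univ, true_and] at hr ⊢
    exact ⟨hr, r.2⟩
  · intro r _; rfl
  · intro r _; rfl

open scoped Classical in
/-- **Telling the prover `π r` can only help it**: `opt_G n h ≤ Σ_s opt_{G|π⁻¹(s)} n h`.
[cite: AroraBarakCC2009, §8.1 (Lemma 8.7 and remarks)] -/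
theorem opt_le_sum_opt_fibre (n : ℕ) (h : List M) :
    G.opt n h ≤ ∑ s, (G.fibre π s).opt n h := by
  induction n generalizing h with
  | zero => exact (G.opt_zero_eq_sum_fibre π h).le
  | succ n ih =>
    by_cases he : Even h.length
    · rw [opt_succ_of_even _ he]
      simp_rw [opt_succ_of_even _ he]
      rw [sum_comm]
      exact sum_le_sum fun a _ => ih (h ++ [a])
    · rw [opt_succ_of_not_even _ he]
      simp_rw [opt_succ_of_not_even _ he]
      refine Finset.sup_le fun b _ => (ih (h ++ [b])).trans (sum_le_sum fun s _ => ?_)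
      exact le_sup (f := fun b : M => (G.fibre π s).opt n (h ++ [b])) (mem_univ b)

open scoped Classical in
/-- The same from the root, with each fibre bounded separately: if every fibre game has value at
most `B s`, then `opt_G k [] ≤ Σ_s B s`. [cite: AroraBarakCC2009, §8.1] -/
theorem opt_nil_le_sum_of_fibre (k : ℕ) (B : S → ℕ) (hB : ∀ s, (G.fibre π s).opt k [] ≤ B s) :
    G.opt k [] ≤ ∑ s, B s :=
  (G.opt_le_sum_opt_fibre π k []).trans (sum_le_sum fun s _ => hB s)

end Fibre

/-! ### A finite family of games in parallel -/

section Pi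

variable {d : ℕ} (G : Fin d → PCGame R M)

/-- **`d` games in parallel**: independent coins `r : Fin d → R`, messages `Fin d → M` (one
component per game), accept iff every component game accepts. The joint prover sees all
histories and may correlate its replies. [folklore] -/
def piGame : PCGame (Fin d → R) (Fin d → M) where
  next r h := fun j => (G j).next (r j) (h.map fun m => m j)
  accept r h := ∀ j, (G j).accept (r j) (h.map fun m => m j)

/-- Consistency in the parallel game is consistency of every component. [folklore] -/
theorem consistent_piGame_iff (r : Fin d → R) (h : List (Fin d → M)) :
    (piGame G).Consistent r h ↔ ∀ j, (G j).Consistent (r j) (h.map fun m => m j) := by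
  induction h using List.reverseRecOn with
  | nil => simp [consistent_nil]
  | append_singleton l x ih =>
    rw [consistent_append_iff, ih]
    simp only [List.map_append, List.map_singleton, consistent_append_iff, List.length_map]
    constructor
    · rintro ⟨h1, h2⟩ j
      exact ⟨h1 j, fun he => by rw [h2 he]; rfl⟩
    · intro hj
      refine ⟨fun j => (hj j).1, fun he => ?_⟩
      funext j
      exact (hj j).2 he

variable [Fintype R] [Fintype M]

open scoped Classical in
/-- **The product bound for a family**: `opt_{Π G} n h ≤ Π_j opt_{G j} n (h.map (· j))` — no
joint prover beats the product of the component optima. [cite: AroraBarakCC2009, §8.1 (Lemma 8.7 and remarks)] -/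
theorem opt_piGame_le (n : ℕ) (h : List (Fin d → M)) :
    (piGame G).opt n h ≤ ∏ j, (G j).opt n (h.map fun m => m j) := by
  induction n generalizing h with
  | zero =>
    simp only [opt_zero]
    -- the accepting consistent coin tuples form a box
    have hbox : (univ.filter fun r : Fin d → R => (piGame G).Consistent r h ∧ (piGame G).accept r h) =
        Fintype.piFinset fun j => univ.filter fun rj : R =>
          (G j).Consistent rj (h.map fun m => m j) ∧ (G j).accept rj (h.map fun m => m j) := by
      ext r
      simp only [mem_filter, mem_univ, true_and, Fintype.mem_piFinset, consistent_piGame_iff]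
      exact ⟨fun ⟨h1, h2⟩ j => ⟨h1 j, h2 j⟩, fun hj => ⟨fun j => (hj j).1, fun j => (hj j).2⟩⟩
    rw [hbox, Fintype.card_piFinset]
  | succ n ih =>
    have hlen : ∀ j, (h.map fun m : Fin d → M => m j).length = h.length := fun j => List.length_map _
    by_cases he : Even h.length
    · rw [opt_succ_of_even _ he]
      simp_rw [opt_succ_of_even _ ((hlen _).symm ▸ he)]
      -- `Π_j Σ_{m} opt_j (h_j ++ [m]) = Σ_{a : Fin d → M} Π_j opt_j (h_j ++ [a j])`
      rw [Finset.prod_univ_sum (t := fun _ => (univ : Finset M))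
        (f := fun j m => (G j).opt n ((h.map fun m' => m' j) ++ [m])), Fintype.piFinset_univ]
      refine sum_le_sum fun a _ => ?_
      have := ih (h ++ [a])
      simpa using this
    · rw [opt_succ_of_not_even _ he]
      simp_rw [opt_succ_of_not_even _ ((hlen _).symm ▸ he)]
      refine Finset.sup_le fun b _ => ?_
      have hb := ih (h ++ [b])
      simp only [List.map_append, List.map_singleton] at hb
      refine hb.trans (prod_le_prod' fun j _ => ?_)
      exact le_sup (f := fun m : M => (G j).opt n ((h.map fun m' => m' j) ++ [m])) (mem_univ (b j))

open scoped Classical in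
/-- From the root: `opt_{Π G} k [] ≤ Π_j opt_{G j} k []`. [cite: AroraBarakCC2009, §8.1] -/
theorem opt_piGame_nil_le (k : ℕ) : (piGame G).opt k [] ≤ ∏ j, (G j).opt k [] := by
  simpa using opt_piGame_le G k []

end Pi

end PCGame

end Literature.Computability.Complexity
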